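import Summits.Ventures.PercRepro.C025ProfilePLDResidualCertificate

/-!
# THE RESIDUAL INEQUALITIES IMPLY PER-LAYER DOMINANCE, IN SUM FORM (night-3 g36)

`proofs/NIGHT3-G36-CEILING.md` §3.  `pld_of_res`: a finite matroid satisfying the residual inequalities `#RS ≤ #THI` at every
`(lo, hi, δ)` (the sum form `hRES` of `PLDResCert.sum_le_of_cert_res`) satisfies `(PLD)[lo, hi, δ; Θ]` at every admissible
`(lo, hi, δ, Θ)` — the binder `hPLD` of the bridge and of the first lift tower.  The proof is the residual reduction of g28
(`PavingPLD.pld_of_paving`, `pld_of_card_residual_le`) with the sum-form hypothesis in place of the `Finset.sigma` one: the left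
side splits into the low sources (corank ≤ hi + δ), which are right-hand pairs or weigh `0`, and the residual sources, which
`hRES` bounds by the high right-hand pairs.  With it the second tower's hypothesis feeds every (PLD)-hypothesis theorem of the
tree (the preservers of the lift in `m`, the bridge, the first tower).  No `def`, no `instance`, no notation.  Axioms: standard.
-/

open scoped Matroid

namespace PercRepro

open Finset ThmH

namespace PLDResCert

variable {α : Type} [DecidableEq α]

/-- THE RESIDUAL INEQUALITIES (sum form) IMPLY (PLD) AT EVERY ADMISSIBLE INSTANCE. -/
theorem pld_of_res (M : Matroid α) [M.Finite]
    (hRES : ∀ lo hi δ : ℕ,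
      (∑ I ∈ (gr M).powerset, (if lo ≤ (M.eRk (I : Set α)).toNat ∧ (M.eRk (I : Set α)).toNat ≤ hi ∧
          hi + δ + 1 ≤ (M.eRk ((gr M \ I : Finset α) : Set α)).toNat then
          ((M.eRk ((gr M \ I : Finset α) : Set α)).toNat).choose δ else 0)) ≤
        ∑ I ∈ (gr M).powerset, (if lo + δ ≤ (M.eRk ((gr M \ I : Finset α) : Set α)).toNat ∧
          (M.eRk ((gr M \ I : Finset α) : Set α)).toNat ≤ hi + δ ∧ hi + 1 ≤ (M.eRk (I : Set α)).toNat then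
          ((M.eRk ((gr M \ I : Finset α) : Set α)).toNat).choose δ else 0)) :
    ∀ lo hi δ Θ : ℕ, Θ ≤ lo + hi + δ → (lo = 0 ∨ lo + hi + δ ≤ Θ) →
      (∑ I ∈ (gr M).powerset, (if lo ≤ (M.eRk (I : Set α)).toNat ∧ (M.eRk (I : Set α)).toNat ≤ hi ∧
          Θ ≤ (M.eRk ((gr M \ I : Finset α) : Set α)).toNat + (M.eRk (I : Set α)).toNat then
          ((M.eRk ((gr M \ I : Finset α) : Set α)).toNat).choose δ else 0)) ≤
        ∑ I ∈ (gr M).powerset, (if lo + δ ≤ (M.eRk ((gr M \ I : Finset α) : Set α)).toNat ∧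
          (M.eRk ((gr M \ I : Finset α) : Set α)).toNat ≤ hi + δ then
          ((M.eRk ((gr M \ I : Finset α) : Set α)).toNat).choose δ else 0) := by
  intro lo hi δ Θ hΘ hside
  -- split the left side into the low part (corank ≤ hi + δ) and the residual part
  have hL : (∑ I ∈ (gr M).powerset, (if lo ≤ (M.eRk (I : Set α)).toNat ∧ (M.eRk (I : Set α)).toNat ≤ hi ∧
          Θ ≤ (M.eRk ((gr M \ I : Finset α) : Set α)).toNat + (M.eRk (I : Set α)).toNat then
          ((M.eRk ((gr M \ I : Finset α) : Set α)).toNat).choose δ else 0)) =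
      (∑ I ∈ (gr M).powerset, (if lo ≤ (M.eRk (I : Set α)).toNat ∧ (M.eRk (I : Set α)).toNat ≤ hi ∧
          Θ ≤ (M.eRk ((gr M \ I : Finset α) : Set α)).toNat + (M.eRk (I : Set α)).toNat ∧
          (M.eRk ((gr M \ I : Finset α) : Set α)).toNat ≤ hi + δ then
          ((M.eRk ((gr M \ I : Finset α) : Set α)).toNat).choose δ else 0)) +
      (∑ I ∈ (gr M).powerset, (if lo ≤ (M.eRk (I : Set α)).toNat ∧ (M.eRk (I : Set α)).toNat ≤ hi ∧
          hi + δ + 1 ≤ (M.eRk ((gr M \ I : Finset α) : Set α)).toNat then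
          ((M.eRk ((gr M \ I : Finset α) : Set α)).toNat).choose δ else 0)) := by
    rw [← sum_add_distrib]
    apply sum_congr rfl
    intro I _
    split_ifs <;> omega
  -- split the right side into the low part (rank ≤ hi) and the high part
  have hR : (∑ I ∈ (gr M).powerset, (if lo + δ ≤ (M.eRk ((gr M \ I : Finset α) : Set α)).toNat ∧
          (M.eRk ((gr M \ I : Finset α) : Set α)).toNat ≤ hi + δ then
          ((M.eRk ((gr M \ I : Finset α) : Set α)).toNat).choose δ else 0)) =
      (∑ I ∈ (gr M).powerset, (if lo + δ ≤ (M.eRk ((gr M \ I : Finset α) : Set α)).toNat ∧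
          (M.eRk ((gr M \ I : Finset α) : Set α)).toNat ≤ hi + δ ∧ (M.eRk (I : Set α)).toNat ≤ hi then
          ((M.eRk ((gr M \ I : Finset α) : Set α)).toNat).choose δ else 0)) +
      (∑ I ∈ (gr M).powerset, (if lo + δ ≤ (M.eRk ((gr M \ I : Finset α) : Set α)).toNat ∧
          (M.eRk ((gr M \ I : Finset α) : Set α)).toNat ≤ hi + δ ∧ hi + 1 ≤ (M.eRk (I : Set α)).toNat then
          ((M.eRk ((gr M \ I : Finset α) : Set α)).toNat).choose δ else 0)) := by
    rw [← sum_add_distrib]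
    apply sum_congr rfl
    intro I _
    split_ifs <;> omega
  rw [hL, hR]
  apply Nat.add_le_add
  · -- low sources are right-hand pairs (or weigh 0)
    apply sum_le_sum
    intro I _
    split_ifs with h1 h2
    · exact le_rfl
    · apply Nat.le_of_eq
      apply Nat.choose_eq_zero_of_lt
      omega
    · exact Nat.zero_le _
    · exact le_rfl
  · -- the residual sources are bounded by the high pairs
    exact hRES lo hi δ

end PLDResCert

end PercRepro
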